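/-
Copyright (c) 2026 the pub-hodgecm-mathlib formalisation cell (harness21).  Prover fan seat hodgecm-mathlib-LH7-p05 (g3) (F0 ∕ P3c ∕ LH7, lent to
Track B «K2-LIT»), hLiu418 = `stmt-HodgeConjecture-24832`; K1a DESK WORD #22 (1) (K2Liu-p01 (g11)) deal (α) ED. 3.  THEOREMS ONLY (no `def`, no instance,
no notation, no named-fact hypothesis, no `sorry`); lane `--supports stmt-HodgeConjecture-24832 --as helper`.
-/
import Summits.HodgeConjecture.HodgeConjecture.Theorems.K2LiuKindOneSingularArchLettersOfRecord    -- ★ p865046∕p865080: the `h`-level producer, `gaussParam_pos`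
import HarnessLib

/-!
# Crux `HLiu418`, socket #41, KIND 1 a♮ — (α) ED. 3 `K2LiuKindOneSingularArchLettersOfRecordG`: the per-fine-face-and-place arch continuation AT THE `g`-LEVEL
# (`Ac₀ : Sk → φ → InfinitePlace L → ℂ → U(J)(ℂ) → ℂ`, the shape ★ p864726 `blockD_arch_of_record` takes), with growth `hAcwb` about `Ac₀ ∘ Frg`

Cell `hodgecm-mathlib`, hLiu418 = `stmt-HodgeConjecture-24832` (helper lane, count-neutral); squad K2 ∕ K2Liu, road `K2_Liu`, KIND 1 a♮; K1a desk K2Liu-p01 (g11), WORD #22.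
THE POINT.  The tie's arch column of record ★ p864726 takes the continuation `Ac₀` per fine face `p` and place `w` as a function of `g ∈ U(J)(ℂ)` (letters `hAc₀ hA₀`) and
DEFINES `Acw := fun X p w s h => Ac₀ X p w s (Frg X h w)`; so the growth letter (iv) `hAcwb` of ★ p864498 must speak about THAT composite.  This file re-packages ★
p865046's proof one level up: `Ac₀ X p w s g := sc X p w s · Ac^{±}_{k p w}(a, tw X w, s, g)` (★ p864912 ∕ ★ p864948 datum-uniform letters, sign split `sgn`, per-place
scalar `sc` OUTSIDE — K1a's (o1) face of record carries `γ X p s` at the distinguished place), and returns (C1) holomorphy in `s` for every `g ∈ U(J)` (★ p864726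
:118–:120 bytes), (C2p)(C2n) the `g`-level agreement `sc·∫ e(∓tr(a·diag(tw,0)·aᴴ·X_r)) f_{s,k}(J n(X_r) g) dr = Ac₀ X p w s g` on `{½ < re s}` by the sign, (C3) `hP1` and
(C4) `hAcwb` of ★ p864498 at `Acw := Ac₀ ∘ Frg` (`Frg X h w = Fr((gc X·h)_∞) w`), `Pw := (1+pw)(1+pw⁻¹)(1+tw)(1+tw⁻¹)(1+Rw)`, `gw := tw·pw`, `cg := π` (constants uniform over
the finitely many `(p, w)` and times the scalar bound `Cs`), (C5)(C6) the sign-letter zeros.  K2E4-p10 (g11)'s (ρ) `theta_eq_of_record` turns (C2) into ★ p864726's `hA₀`.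
* **`archLetters_of_scalarTypeGrowth_g`**.
[Shimura1982, §4 Thm. 4.2, (4.34.K)], [Shimura1997, §18.4–18.5], [KudlaRallis1994, §2 (2.10)–(2.12)], [GanQiuTakeda2014, §6.4].
HONEST LABEL.  Re-packaging, count-neutral; closes no socket: `HC_CM` is proved only modulo the 7 printed citations (2 remaining named inputs: hLiu418 =
`stmt-HodgeConjecture-24832`, h413 = `stmt-HodgeConjecture-24833`) until rung 0 closes.
-/

set_option autoImplicit false
set_option linter.dupNamespace false -- the mandated namespace repeats `HodgeConjecture.HodgeConjecture`

noncomputable section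

open scoped Matrix ComplexConjugate ComplexOrder
open Complex Matrix NumberField NumberField.InfinitePlace IsDedekindDomain MeasureTheory
open Literature.NumberTheory.ModularForms.SiegelUpperHalfSpace (moeb)
open Literature.NumberTheory.Automorphic Literature.NumberTheory.Automorphic.UnitaryGroup Literature.NumberTheory.GaloisRepresentations
open Literature.NumberTheory.GelbartRogawski1991 Literature.NumberTheory.GelbartRogawski1991.GRConstruction

namespace Summit.HodgeConjecture.HodgeConjecture.Cruxes.HLiu418.K2LiuKindOneSingularArchLettersOfRecordG

open K2LiuSiegelUnipotentFourierDefs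
open K2LiuHermTwoGammaDefs (hermTwo)
open K2LiuArchInducedTubeDefs (hermOfReal archScalarSection)
open K2LiuHermTwoEtaRankOneWitnessGrowth (one_le_envFactor)
open K2LiuArchTwistedScalarLettersGrowthPi (exists_archLetters_scalarType_explicit_growth)
open K2LiuArchTwistedScalarLettersGrowthNeg (exists_archLetters_scalarType_explicit_neg_growth)
open K2LiuKindOneSingularArchLettersOfRecord (gaussParam_pos)

variable (L : Type) [Field L] [NumberField L] [IsCMField L] {N M : ℕ} (e : Fin N × Fin M ≃ Fin 2)
  (dV : Fin N → L) (hdV : ∀ i, IsCMField.complexConj L (dV i) = dV i)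
  (dW : Fin M → L) (hdW : ∀ i, IsCMField.complexConj L (dW i) = dW i)

/-- **THE `g`-LEVEL ARCH ALPHABET PRODUCER (ED. 3).**  Inputs by value as in ★ p865080 `archLetters_of_scalarTypeGrowth_sc` minus the local block: faces `I`, places
`Tinf`, frame `a` (`‖det a‖ = 1`), translate `gc`, tube frame `Fr ∈ U(J)` (`hFrU`), `tw > 0`, `pw` read as ★ p864004's exponent at the translate (`hpw_eq`), entry bound
`Rw` (`hRw`), `K_∞`-types `k` at depth `Nd`, sign split `sgn`, per-place scalar `sc` (`hsc hscb`).  Output: `Ac₀` at the `g`-level with (C1) = ★ p864726's `hAc₀`,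
(C2p∕C2n) the agreement with `sc·∫(±, g)` on `{½ < re s}`, (C3) `hP1`, (C4) `hAcwb` of ★ p864498 about `Ac₀ X p w s (Fr((gc X·h)_∞) w)`, (C5)(C6) the zeros.
[cite: Shimura1982, §4 Thm. 4.2, (4.34.K)] [cite: Shimura1997, §18.4–18.5] [cite: KudlaRallis1994, §2 (2.10)–(2.12)] -/
theorem archLetters_of_scalarTypeGrowth_g {φ : Type*} [Fintype φ]
    (I : skewMatrices ((IsCMField.complexConj L : L ≃ₐ[Fp L] L) : L →+* L) ((gramR L e dV hdV dW hdW).map (algebraMap (Fp L) L)) → HA L e dV hdV dW hdW → Finset φ)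
    (Tinf : Finset (InfinitePlace L))
    (a : Matrix (Fin 2) (Fin 2) ℂ) (ha : ‖a.det‖ = 1)
    (gc : skewMatrices ((IsCMField.complexConj L : L ≃ₐ[Fp L] L) : L →+* L) ((gramR L e dV hdV dW hdW).map (algebraMap (Fp L) L)) → HA L e dV hdV dW hdW)
    (Fr : UnitaryGroup.arch (Fp L) L (IsCMField.complexConj L) (2 + 2) (hermD L e dV hdV dW hdW) → {w : InfinitePlace L // w.IsComplex} →
      Matrix (Fin 2 ⊕ Fin 2) (Fin 2 ⊕ Fin 2) ℂ)
    (hFrU : ∀ (x : UnitaryGroup.arch (Fp L) L (IsCMField.complexConj L) (2 + 2) (hermD L e dV hdV dW hdW)) (w : {w : InfinitePlace L // w.IsComplex}),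
      (Fr x w)ᴴ * Matrix.J (Fin 2) ℂ * Fr x w = Matrix.J (Fin 2) ℂ)
    (tw : skewMatrices ((IsCMField.complexConj L : L ≃ₐ[Fp L] L) : L →+* L) ((gramR L e dV hdV dW hdW).map (algebraMap (Fp L) L)) → InfinitePlace L → ℝ)
    (htw0 : ∀ X : skewMatrices ((IsCMField.complexConj L : L ≃ₐ[Fp L] L) : L →+* L) ((gramR L e dV hdV dW hdW).map (algebraMap (Fp L) L)),
      (X : Matrix (Fin 2) (Fin 2) L) ≠ 0 → (X : Matrix (Fin 2) (Fin 2) L).det = 0 → ∀ w' ∈ Tinf, 0 < tw X w')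
    (pw Rw : skewMatrices ((IsCMField.complexConj L : L ≃ₐ[Fp L] L) : L →+* L) ((gramR L e dV hdV dW hdW).map (algebraMap (Fp L) L)) → HA L e dV hdV dW hdW →
      InfinitePlace L → ℝ)
    (hpw_eq : ∀ (X : skewMatrices ((IsCMField.complexConj L : L ≃ₐ[Fp L] L) : L →+* L) ((gramR L e dV hdV dW hdW).map (algebraMap (Fp L) L)))
      (h : HA L e dV hdV dW hdW) (w' : InfinitePlace L),
      pw X h w' = ((aᴴ * ((2 : ℂ) • ((2 * Complex.I)⁻¹ •
        (moeb (Fr (UnitaryGroup.archPart (Fp L) L (IsCMField.complexConj L) (2 + 2) (hermD L e dV hdV dW hdW) (gc X * h)) ⟨w', IsTotallyComplex.isComplex w'⟩)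
            (Complex.I • (1 : Matrix (Fin 2) (Fin 2) ℂ)) -
          (moeb (Fr (UnitaryGroup.archPart (Fp L) L (IsCMField.complexConj L) (2 + 2) (hermD L e dV hdV dW hdW) (gc X * h)) ⟨w', IsTotallyComplex.isComplex w'⟩)
            (Complex.I • (1 : Matrix (Fin 2) (Fin 2) ℂ)))ᴴ))) * a) 0 0).re)
    (hRw : ∀ (X : skewMatrices ((IsCMField.complexConj L : L ≃ₐ[Fp L] L) : L →+* L) ((gramR L e dV hdV dW hdW).map (algebraMap (Fp L) L)))
      (h : HA L e dV hdV dW hdW), ∀ w' ∈ Tinf, ∀ i j,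
      ‖Fr (UnitaryGroup.archPart (Fp L) L (IsCMField.complexConj L) (2 + 2) (hermD L e dV hdV dW hdW) (gc X * h)) ⟨w', IsTotallyComplex.isComplex w'⟩ i j‖ ≤ Rw X h w')
    (k : φ → {w : InfinitePlace L // w.IsComplex} → ℤ) (Nd : ℕ)
    (hNp : ∀ i w, (k i w : ℝ) / 2 < Nd) (hNn : ∀ i w, -(k i w : ℝ) / 2 < Nd)
    (sgn : skewMatrices ((IsCMField.complexConj L : L ≃ₐ[Fp L] L) : L →+* L) ((gramR L e dV hdV dW hdW).map (algebraMap (Fp L) L)) → InfinitePlace L → Bool)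
    (sc : skewMatrices ((IsCMField.complexConj L : L ≃ₐ[Fp L] L) : L →+* L) ((gramR L e dV hdV dW hdW).map (algebraMap (Fp L) L)) → φ → InfinitePlace L → ℂ → ℂ)
    (hsc : ∀ (X : skewMatrices ((IsCMField.complexConj L : L ≃ₐ[Fp L] L) : L →+* L) ((gramR L e dV hdV dW hdW).map (algebraMap (Fp L) L))) (i : φ)
      (w' : InfinitePlace L), DifferentiableOn ℂ (sc X i w') {s : ℂ | 0 < s.re})
    (hscb : ∀ z : ℂ, 0 < z.re → ∃ (Cs rs : ℝ), 0 ≤ Cs ∧ 0 < rs ∧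
      ∀ X : skewMatrices ((IsCMField.complexConj L : L ≃ₐ[Fp L] L) : L →+* L) ((gramR L e dV hdV dW hdW).map (algebraMap (Fp L) L)),
      (X : Matrix (Fin 2) (Fin 2) L) ≠ 0 → (X : Matrix (Fin 2) (Fin 2) L).det = 0 → ∀ (h : HA L e dV hdV dW hdW), ∀ i ∈ I X h, ∀ w' ∈ Tinf,
      ∀ s : ℂ, dist s z < rs → ‖sc X i w' s‖ ≤ Cs) :
    ∃ Ac₀ : skewMatrices ((IsCMField.complexConj L : L ≃ₐ[Fp L] L) : L →+* L) ((gramR L e dV hdV dW hdW).map (algebraMap (Fp L) L)) → φ → InfinitePlace L → ℂ →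
        Matrix (Fin 2 ⊕ Fin 2) (Fin 2 ⊕ Fin 2) ℂ → ℂ,
      -- (C1) `hAc₀` (★ p864726 :118–:120, at `∀ p ∈ I X h`)
      (∀ X : skewMatrices ((IsCMField.complexConj L : L ≃ₐ[Fp L] L) : L →+* L) ((gramR L e dV hdV dW hdW).map (algebraMap (Fp L) L)),
        (X : Matrix (Fin 2) (Fin 2) L) ≠ 0 → (X : Matrix (Fin 2) (Fin 2) L).det = 0 → ∀ (h : HA L e dV hdV dW hdW), ∀ p ∈ I X h, ∀ w ∈ Tinf,
          ∀ g : Matrix (Fin 2 ⊕ Fin 2) (Fin 2 ⊕ Fin 2) ℂ, gᴴ * Matrix.J (Fin 2) ℂ * g = Matrix.J (Fin 2) ℂ →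
            DifferentiableOn ℂ (fun s => Ac₀ X p w s g) {s : ℂ | 0 < s.re}) ∧
      -- (C2p) the `g`-level agreement, positive framed corner index, scalar outside
      (∀ X : skewMatrices ((IsCMField.complexConj L : L ≃ₐ[Fp L] L) : L →+* L) ((gramR L e dV hdV dW hdW).map (algebraMap (Fp L) L)),
        (X : Matrix (Fin 2) (Fin 2) L) ≠ 0 → (X : Matrix (Fin 2) (Fin 2) L).det = 0 → ∀ (h : HA L e dV hdV dW hdW), ∀ p ∈ I X h, ∀ w ∈ Tinf, sgn X w = true →
          ∀ s : ℂ, 1 / 2 < s.re → ∀ g : Matrix (Fin 2 ⊕ Fin 2) (Fin 2 ⊕ Fin 2) ℂ, gᴴ * Matrix.J (Fin 2) ℂ * g = Matrix.J (Fin 2) ℂ →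
          sc X p w s * (∫ r : Fin 2 → Fin 2 → ℝ, cexp (-(2 * Real.pi * Complex.I) * ((a * hermTwo (tw X w, 0, 0) * aᴴ) * hermOfReal r).trace) *
            archScalarSection (k p ⟨w, IsTotallyComplex.isComplex w⟩) s (Matrix.J (Fin 2) ℂ * fromBlocks 1 (hermOfReal r) 0 1 * g)) = Ac₀ X p w s g) ∧
      -- (C2n) the `g`-level agreement, negative framed corner index, scalar outside
      (∀ X : skewMatrices ((IsCMField.complexConj L : L ≃ₐ[Fp L] L) : L →+* L) ((gramR L e dV hdV dW hdW).map (algebraMap (Fp L) L)),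
        (X : Matrix (Fin 2) (Fin 2) L) ≠ 0 → (X : Matrix (Fin 2) (Fin 2) L).det = 0 → ∀ (h : HA L e dV hdV dW hdW), ∀ p ∈ I X h, ∀ w ∈ Tinf, sgn X w = false →
          ∀ s : ℂ, 1 / 2 < s.re → ∀ g : Matrix (Fin 2 ⊕ Fin 2) (Fin 2 ⊕ Fin 2) ℂ, gᴴ * Matrix.J (Fin 2) ℂ * g = Matrix.J (Fin 2) ℂ →
          sc X p w s * (∫ r : Fin 2 → Fin 2 → ℝ, cexp (-(2 * Real.pi * Complex.I) * ((-(a * hermTwo (tw X w, 0, 0) * aᴴ)) * hermOfReal r).trace) *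
            archScalarSection (k p ⟨w, IsTotallyComplex.isComplex w⟩) s (Matrix.J (Fin 2) ℂ * fromBlocks 1 (hermOfReal r) 0 1 * g)) = Ac₀ X p w s g) ∧
      -- (C3) `hP1` (★ p864498 :114–:115) at the booked `Pw`
      (∀ (X : skewMatrices ((IsCMField.complexConj L : L ≃ₐ[Fp L] L) : L →+* L) ((gramR L e dV hdV dW hdW).map (algebraMap (Fp L) L))) (h : HA L e dV hdV dW hdW),
        (X : Matrix (Fin 2) (Fin 2) L) ≠ 0 → (X : Matrix (Fin 2) (Fin 2) L).det = 0 → ∀ w ∈ Tinf,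
          1 ≤ ((1 + pw X h w) * (1 + (pw X h w)⁻¹)) * ((1 + tw X w) * (1 + (tw X w)⁻¹)) * (1 + Rw X h w)) ∧
      -- (C4) `hAcwb` (★ p864498 :116–:119) at `Acw := fun X i w s h => Ac₀ X i w s (Fr ((gc X·h)_∞) w)`, the booked `Pw`, `gw := tw·pw`
      (∀ z : ℂ, 0 < z.re → ∃ (Mg : ℕ) (Cg cg rg : ℝ), 0 ≤ Cg ∧ 0 < cg ∧ 0 < rg ∧
        ∀ (X : skewMatrices ((IsCMField.complexConj L : L ≃ₐ[Fp L] L) : L →+* L) ((gramR L e dV hdV dW hdW).map (algebraMap (Fp L) L))) (s : ℂ), dist s z < rg →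
        ∀ h : HA L e dV hdV dW hdW, (X : Matrix (Fin 2) (Fin 2) L) ≠ 0 → (X : Matrix (Fin 2) (Fin 2) L).det = 0 → ∀ i ∈ I X h, ∀ w ∈ Tinf,
          ‖Ac₀ X i w s (Fr (UnitaryGroup.archPart (Fp L) L (IsCMField.complexConj L) (2 + 2) (hermD L e dV hdV dW hdW) (gc X * h)) ⟨w, IsTotallyComplex.isComplex w⟩)‖ ≤
            Cg * (((1 + pw X h w) * (1 + (pw X h w)⁻¹)) * ((1 + tw X w) * (1 + (tw X w)⁻¹)) * (1 + Rw X h w)) ^ Mg * Real.exp (-(cg * (tw X w * pw X h w)))) ∧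
      -- (C5) `hZp`: the sign-letter zeros on the positive side, `g`-level
      (∀ (X : skewMatrices ((IsCMField.complexConj L : L ≃ₐ[Fp L] L) : L →+* L) ((gramR L e dV hdV dW hdW).map (algebraMap (Fp L) L))) (i : φ) (w : InfinitePlace L)
        (s : ℂ) (g : Matrix (Fin 2 ⊕ Fin 2) (Fin 2 ⊕ Fin 2) ℂ), sgn X w = true →
        ((∃ m : ℕ, s + 1 - k i ⟨w, IsTotallyComplex.isComplex w⟩ / 2 = -(m : ℂ)) ∨
          (∃ m : ℕ, s + 1 + k i ⟨w, IsTotallyComplex.isComplex w⟩ / 2 = -(m : ℂ) ∨ s + 1 + k i ⟨w, IsTotallyComplex.isComplex w⟩ / 2 - 1 = -(m : ℂ))) →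
        Ac₀ X i w s g = 0) ∧
      -- (C6) `hZn`: the sign-letter zeros on the negative side, `g`-level
      (∀ (X : skewMatrices ((IsCMField.complexConj L : L ≃ₐ[Fp L] L) : L →+* L) ((gramR L e dV hdV dW hdW).map (algebraMap (Fp L) L))) (i : φ) (w : InfinitePlace L)
        (s : ℂ) (g : Matrix (Fin 2 ⊕ Fin 2) (Fin 2 ⊕ Fin 2) ℂ), sgn X w = false →
        ((∃ m : ℕ, s + 1 + k i ⟨w, IsTotallyComplex.isComplex w⟩ / 2 = -(m : ℂ)) ∨
          (∃ m : ℕ, s + 1 - k i ⟨w, IsTotallyComplex.isComplex w⟩ / 2 = -(m : ℂ) ∨ s + 1 - k i ⟨w, IsTotallyComplex.isComplex w⟩ / 2 - 1 = -(m : ℂ))) →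
        Ac₀ X i w s g = 0) := by
  -- the two datum-uniform letter packages, one per `K_∞`-type `k : ℤ`, chosen once (before `X`)
  choose Acp hAcp hAp hZβp hZαp hGp using fun (k' : ℤ) (hk : (k' : ℝ) / 2 < Nd) => exists_archLetters_scalarType_explicit_growth k' Nd hk
  choose Acn hAcn hAn hZαn hZβn hGn using fun (k' : ℤ) (hk : -(k' : ℝ) / 2 < Nd) => exists_archLetters_scalarType_explicit_neg_growth k' Nd hk
  refine ⟨fun X i w s g => sc X i w s * (bif sgn X w then Acp (k i ⟨w, IsTotallyComplex.isComplex w⟩) (hNp i _) a (tw X w) s g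
      else Acn (k i ⟨w, IsTotallyComplex.isComplex w⟩) (hNn i _) a (tw X w) s g), ?_, ?_, ?_, ?_, ?_, ?_, ?_⟩
  · -- (C1)
    intro X hX hdet h i _ w hw g hg
    cases hb : sgn X w with
    | true =>
      simp only [hb, cond_true]
      exact (hsc X i w).mul (hAcp _ (hNp i _) a (tw X w) ha (htw0 X hX hdet w hw) g hg)
    | false =>
      simp only [hb, cond_false]
      exact (hsc X i w).mul (hAcn _ (hNn i _) a (tw X w) ha (htw0 X hX hdet w hw) g hg)
  · -- (C2p)
    intro X hX hdet h i _ w hw hb s hs g hg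
    simp only [hb, cond_true]
    exact congrArg (fun y => sc X i w s * y) (hAp _ (hNp i _) a (tw X w) ha (htw0 X hX hdet w hw) s hs g hg)
  · -- (C2n)
    intro X hX hdet h i _ w hw hb s hs g hg
    simp only [hb, cond_false]
    exact congrArg (fun y => sc X i w s * y) (hAn _ (hNn i _) a (tw X w) ha (htw0 X hX hdet w hw) s hs g hg)
  · -- (C3) `hP1`
    intro X h hX hdet w hw
    have hp : 0 < pw X h w := by rw [hpw_eq]; exact gaussParam_pos ha (hFrU _ _)
    have hR0 : 0 ≤ Rw X h w := (norm_nonneg _).trans (hRw X h w hw (Sum.inl 0) (Sum.inl 0))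
    exact one_le_mul_of_one_le_of_one_le (one_le_mul_of_one_le_of_one_le (one_le_envFactor hp) (one_le_envFactor (htw0 X hX hdet w hw)))
      (le_add_of_nonneg_right hR0)
  · -- (C4) `hAcwb`: the (v) packages at every `k i w`, uniformized over the finitely many `(i, w)`, times the scalar bound
    intro z hz
    choose Mp Cp rp hCp hrp hBp using fun p : φ × InfinitePlace L => hGp (k p.1 ⟨p.2, IsTotallyComplex.isComplex p.2⟩) (hNp p.1 _) z hz
    choose Mn Cn rn hCn hrn hBn using fun p : φ × InfinitePlace L => hGn (k p.1 ⟨p.2, IsTotallyComplex.isComplex p.2⟩) (hNn p.1 _) z hz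
    obtain ⟨Cs, rs, hCs, hrs, hS⟩ := hscb z hz
    have hCp0 : 0 ≤ ∑ q : φ × InfinitePlace L, Cp q := Finset.sum_nonneg fun q _ => hCp q
    have hCn0 : 0 ≤ ∑ q : φ × InfinitePlace L, Cn q := Finset.sum_nonneg fun q _ => hCn q
    have hS0 : 0 ≤ ∑ q : φ × InfinitePlace L, ((rp q)⁻¹ + (rn q)⁻¹) :=
      Finset.sum_nonneg fun q _ => add_nonneg (inv_nonneg.2 (hrp q).le) (inv_nonneg.2 (hrn q).le)
    refine ⟨Finset.univ.sup Mp + Finset.univ.sup Mn, Cs * ((∑ q : φ × InfinitePlace L, Cp q) + ∑ q : φ × InfinitePlace L, Cn q), Real.pi,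
      min rs (1 + ∑ q : φ × InfinitePlace L, ((rp q)⁻¹ + (rn q)⁻¹))⁻¹, mul_nonneg hCs (add_nonneg hCp0 hCn0), Real.pi_pos,
      lt_min hrs (by positivity), ?_⟩
    intro X s hs h hX hdet i hi w hw
    have hss : dist s z < rs := hs.trans_le (min_le_left _ _)
    have hs' : dist s z < (1 + ∑ q : φ × InfinitePlace L, ((rp q)⁻¹ + (rn q)⁻¹))⁻¹ := hs.trans_le (min_le_right _ _)
    have hmem : (i, w) ∈ (Finset.univ : Finset (φ × InfinitePlace L)) := Finset.mem_univ _
    have hsum1 : (rp (i, w))⁻¹ + (rn (i, w))⁻¹ ≤ 1 + ∑ q : φ × InfinitePlace L, ((rp q)⁻¹ + (rn q)⁻¹) :=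
      (Finset.single_le_sum (f := fun q => (rp q)⁻¹ + (rn q)⁻¹) (fun q _ => add_nonneg (inv_nonneg.2 (hrp q).le) (inv_nonneg.2 (hrn q).le)) hmem).trans
        (le_add_of_nonneg_left zero_le_one)
    have hsp : dist s z < rp (i, w) :=
      hs'.trans_le (inv_le_of_inv_le₀ (hrp _) ((le_add_of_nonneg_right (inv_nonneg.2 (hrn _).le)).trans hsum1))
    have hsn : dist s z < rn (i, w) :=
      hs'.trans_le (inv_le_of_inv_le₀ (hrn _) ((le_add_of_nonneg_left (inv_nonneg.2 (hrp _).le)).trans hsum1))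
    have ht := htw0 X hX hdet w hw
    have hp : 0 < pw X h w := by rw [hpw_eq]; exact gaussParam_pos ha (hFrU _ _)
    have hR0 : 0 ≤ Rw X h w := (norm_nonneg _).trans (hRw X h w hw (Sum.inl 0) (Sum.inl 0))
    have hSz1 : 1 ≤ ((1 + pw X h w) * (1 + (pw X h w)⁻¹)) * ((1 + tw X w) * (1 + (tw X w)⁻¹)) * (1 + Rw X h w) :=
      one_le_mul_of_one_le_of_one_le (one_le_mul_of_one_le_of_one_le (one_le_envFactor hp) (one_le_envFactor ht)) (le_add_of_nonneg_right hR0)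
    have hCpq : Cp (i, w) ≤ (∑ q : φ × InfinitePlace L, Cp q) + ∑ q : φ × InfinitePlace L, Cn q :=
      (Finset.single_le_sum (f := Cp) (fun q _ => hCp q) hmem).trans (le_add_of_nonneg_right hCn0)
    have hCnq : Cn (i, w) ≤ (∑ q : φ × InfinitePlace L, Cp q) + ∑ q : φ × InfinitePlace L, Cn q :=
      (Finset.single_le_sum (f := Cn) (fun q _ => hCn q) hmem).trans (le_add_of_nonneg_left hCp0)
    have hMp : Mp (i, w) ≤ Finset.univ.sup Mp + Finset.univ.sup Mn := (Finset.le_sup (f := Mp) hmem).trans (Nat.le_add_right _ _)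
    have hMn : Mn (i, w) ≤ Finset.univ.sup Mp + Finset.univ.sup Mn := (Finset.le_sup (f := Mn) hmem).trans (Nat.le_add_left _ _)
    have hscle := hS X hX hdet h i hi w hw s hss
    rw [norm_mul]
    cases hb : sgn X w with
    | true =>
      simp only [cond_true]
      have hB := hBp (i, w) a (tw X w) ha ht _ (hFrU (UnitaryGroup.archPart (Fp L) L (IsCMField.complexConj L) (2 + 2) (hermD L e dV hdV dW hdW) (gc X * h))
        ⟨w, IsTotallyComplex.isComplex w⟩) (Rw X h w) (hRw X h w hw) s hsp
      rw [← hpw_eq X h w, mul_comm (pw X h w) (tw X w)] at hB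
      calc ‖sc X i w s‖ * ‖Acp (k i ⟨w, IsTotallyComplex.isComplex w⟩) (hNp i ⟨w, IsTotallyComplex.isComplex w⟩) a (tw X w) s (Fr (UnitaryGroup.archPart (Fp L) L (IsCMField.complexConj L) (2 + 2) (hermD L e dV hdV dW hdW) (gc X * h)) ⟨w, IsTotallyComplex.isComplex w⟩)‖
          ≤ Cs * (((∑ q : φ × InfinitePlace L, Cp q) + ∑ q : φ × InfinitePlace L, Cn q) * (((1 + pw X h w) * (1 + (pw X h w)⁻¹)) * ((1 + tw X w) * (1 + (tw X w)⁻¹)) * (1 + Rw X h w)) ^ (Finset.univ.sup Mp + Finset.univ.sup Mn) *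
              Real.exp (-(Real.pi * (tw X w * pw X h w)))) :=
            mul_le_mul hscle (hB.trans (mul_le_mul (mul_le_mul hCpq (pow_le_pow_right₀ hSz1 hMp) (by positivity) (add_nonneg hCp0 hCn0)) le_rfl
              (Real.exp_pos _).le (by positivity))) (norm_nonneg _) hCs
        _ = _ := by ring
    | false =>
      simp only [cond_false]
      have hB := hBn (i, w) a (tw X w) ha ht _ (hFrU (UnitaryGroup.archPart (Fp L) L (IsCMField.complexConj L) (2 + 2) (hermD L e dV hdV dW hdW) (gc X * h))
        ⟨w, IsTotallyComplex.isComplex w⟩) (Rw X h w) (hRw X h w hw) s hsn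
      rw [← hpw_eq X h w, mul_comm (pw X h w) (tw X w)] at hB
      calc ‖sc X i w s‖ * ‖Acn (k i ⟨w, IsTotallyComplex.isComplex w⟩) (hNn i ⟨w, IsTotallyComplex.isComplex w⟩) a (tw X w) s (Fr (UnitaryGroup.archPart (Fp L) L (IsCMField.complexConj L) (2 + 2) (hermD L e dV hdV dW hdW) (gc X * h)) ⟨w, IsTotallyComplex.isComplex w⟩)‖
          ≤ Cs * (((∑ q : φ × InfinitePlace L, Cp q) + ∑ q : φ × InfinitePlace L, Cn q) * (((1 + pw X h w) * (1 + (pw X h w)⁻¹)) * ((1 + tw X w) * (1 + (tw X w)⁻¹)) * (1 + Rw X h w)) ^ (Finset.univ.sup Mp + Finset.univ.sup Mn) *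
              Real.exp (-(Real.pi * (tw X w * pw X h w)))) :=
            mul_le_mul hscle (hB.trans (mul_le_mul (mul_le_mul hCnq (pow_le_pow_right₀ hSz1 hMn) (by positivity) (add_nonneg hCp0 hCn0)) le_rfl
              (Real.exp_pos _).le (by positivity))) (norm_nonneg _) hCs
        _ = _ := by ring
  · -- (C5) `hZp`
    intro X i w s g hb hz'
    refine mul_eq_zero_of_right _ ?_
    simp only [hb, cond_true]
    rcases hz' with hβ | hα
    · exact hZβp _ (hNp i _) a (tw X w) s _ hβ
    · exact hZαp _ (hNp i _) a (tw X w) s _ hα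
  · -- (C6) `hZn`
    intro X i w s g hb hz'
    refine mul_eq_zero_of_right _ ?_
    simp only [hb, cond_false]
    rcases hz' with hα | hβ
    · exact hZαn _ (hNn i _) a (tw X w) s _ hα
    · exact hZβn _ (hNn i _) a (tw X w) s _ hβ

end Summit.HodgeConjecture.HodgeConjecture.Cruxes.HLiu418.K2LiuKindOneSingularArchLettersOfRecordG

end
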